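import Literature.MathematicalPhysics.QuantumLattice.QuantumRotorFourierBridge
import Mathlib.Analysis.Fourier.AddCircleMulti
import Mathlib.MeasureTheory.Measure.Haar.NormedSpace
import Mathlib.MeasureTheory.Integral.IntervalIntegral.Periodic
import HarnessLib

/-!
# Quantum rotators: Fourier coefficients on the cell and Parseval (transfer from `UnitAddTorus`)

Sibling file of `QuantumRotorFourierBridge.lean` (item
`provefact-Literature.MathematicalPhysics.QuantumLa-0bccfc6de5`, the named fact
`QuantumRotor.KleinPerez1992_rotorGroundStateLRO`). No statement is touched. The density of
trigonometric polynomials among the trial states of `QuantumRotorGroundState.lean` (the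
continuum limit `M → ∞` of the Galerkin ground-state energies) rests on the completeness of the
Fourier system on the torus; this file transfers Mathlib's `L²` theory of the
`UnitAddTorus Λ = (ℝ/ℤ)^Λ` (`Mathlib.Analysis.Fourier.AddCircleMulti`: the Hilbert basis
`mFourierBasis` and **Parseval** `hasSum_sq_mFourierCoeff`) to continuous functions on `ℝ^Λ`
that are `2π`-periodic in every coordinate, integrated over the cell `[-π, π)^Λ`:

* `periodic_shift` — periodicity in each angle gives invariance under the lattice `2πℤ^Λ`;
* `toTorusFn G` — the descent of such a `G` to the unit torus (`t ↦ G(2π·lift t)`), with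
  `toTorusFn G (y mod 1) = G(2π y)` (`toTorusFn_coe`), measurable and bounded, hence in `L²`;
* `mFourierCoeff_toTorusL2` — its Mathlib Fourier coefficients are `(2π)^{-|Λ|}` times the cell
  coefficients `fourierCoeffCell G n = ∫_{[-π,π)^Λ} G conj(e_n)` (change of variables `φ = 2πy`
  and `∏ Ioc ≐ ∏ Ico` a.e.); `integral_norm_sq_toTorusL2` — the same for `∫ |·|²`;
* **Parseval on the cell** (`hasSum_sq_fourierCoeffCell`): `Σ_n |∫ G conj(e_n)|² = (2π)^{|Λ|} ∫ |G|²`;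
* the Galerkin boxes `{n(σ) : σ}` exhaust `ℤ^Λ`, so the box sums converge
  (`tendsto_sum_sq_fourierCoeffCell_box`), and by Pythagoras
  (`integral_norm_sq_sub_fourierPartialSum`) the **box partial sums converge in mean square**:
  `∫_{[-π,π)^Λ} |G - S_M G|² → 0` (`tendsto_integral_norm_sq_sub_fourierPartialSum`).

## References

* A. Klein, J. F. Perez, Commun. Math. Phys. 147 (1992) 241–252, §3 (the momentum basis)
  [KleinPerez1992].
-/

noncomputable section

open MeasureTheory Matrix Complex Finset Set Filter Topology
open scoped ENNReal NNReal ComplexConjugate Pointwise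

namespace Literature.MathematicalPhysics.QuantumLattice

namespace QuantumRotor

/-- As in `Mathlib.Analysis.Fourier.AddCircleMulti`, normalise the measure on `ℝ/ℤ` to Haar
probability measure (so that `volume` on the torus below is literally Mathlib's); file-local.
[folklore] -/
local instance rotorCell_measureSpaceUnitAddCircle : MeasureSpace UnitAddCircle :=
  ⟨AddCircle.haarAddCircle⟩

/-- The file-local `volume` on `ℝ/ℤ` is an additive Haar measure (it is `haarAddCircle`), as in
`Mathlib.Analysis.Fourier.AddCircleMulti`. [folklore] -/
local instance rotorCell_isAddHaarMeasure_unitAddCircle :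
    Measure.IsAddHaarMeasure (volume : Measure UnitAddCircle) :=
  inferInstanceAs (Measure.IsAddHaarMeasure AddCircle.haarAddCircle)

/-- The file-local `volume` on `ℝ/ℤ` is a probability measure (it is `haarAddCircle`), as in
`Mathlib.Analysis.Fourier.AddCircleMulti`. [folklore] -/
local instance rotorCell_isProbabilityMeasure_unitAddCircle :
    IsProbabilityMeasure (volume : Measure UnitAddCircle) :=
  inferInstanceAs (IsProbabilityMeasure AddCircle.haarAddCircle)


variable {Λ : Type} [Fintype Λ] [DecidableEq Λ]

/-! ### Periodicity in each angle is invariance under `2πℤ^Λ` -/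

omit [Fintype Λ] in
/-- Integer multiples in one angle. [folklore] -/
theorem periodic_single_int {B : Type*} (G : (Λ → ℝ) → B)
    (hG : ∀ (φ : Λ → ℝ) (x : Λ), G (φ + Pi.single x (2 * Real.pi)) = G φ) (x : Λ) (n : ℤ) (φ : Λ → ℝ) :
    G (φ + Pi.single x ((n : ℝ) * (2 * Real.pi))) = G φ := by
  induction n using Int.induction_on generalizing φ with
  | zero => simp
  | succ k ih =>
    have : Pi.single x ((((k : ℤ) + 1 : ℤ) : ℝ) * (2 * Real.pi)) =
        (Pi.single x (((k : ℤ) : ℝ) * (2 * Real.pi)) : Λ → ℝ) + Pi.single x (2 * Real.pi) := by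
      rw [← Pi.single_add]; congr 1; push_cast; ring
    rw [this, ← add_assoc, hG, ih]
  | pred k ih =>
    have : Pi.single x (((-(k : ℤ) - 1 : ℤ) : ℝ) * (2 * Real.pi)) =
        (Pi.single x (((-(k : ℤ) : ℤ) : ℝ) * (2 * Real.pi)) : Λ → ℝ) +
          (Pi.single x (-(2 * Real.pi)) : Λ → ℝ) := by
      rw [← Pi.single_add]; congr 1; push_cast; ring
    rw [this, ← add_assoc]
    calc G (φ + Pi.single x (((-(k : ℤ) : ℤ) : ℝ) * (2 * Real.pi)) + (Pi.single x (-(2 * Real.pi)) : Λ → ℝ))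
        = G (φ + Pi.single x (((-(k : ℤ) : ℤ) : ℝ) * (2 * Real.pi)) + (Pi.single x (-(2 * Real.pi)) : Λ → ℝ) +
            Pi.single x (2 * Real.pi)) := (hG _ x).symm
      _ = G (φ + Pi.single x (((-(k : ℤ) : ℤ) : ℝ) * (2 * Real.pi))) := by
          congr 1
          rw [add_assoc (φ + _), ← Pi.single_add, neg_add_cancel, Pi.single_zero, add_zero]
      _ = G φ := ih φ

/-- **Periodicity in each angle gives invariance under the lattice `2πℤ^Λ`.** [folklore] -/
theorem periodic_shift {B : Type*} (G : (Λ → ℝ) → B)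
    (hG : ∀ (φ : Λ → ℝ) (x : Λ), G (φ + Pi.single x (2 * Real.pi)) = G φ) (k : Λ → ℤ) (φ : Λ → ℝ) :
    G (φ + fun x => (k x : ℝ) * (2 * Real.pi)) = G φ := by
  have key : ∀ s : Finset Λ, ∀ φ : Λ → ℝ,
      G (φ + ∑ x ∈ s, Pi.single x ((k x : ℝ) * (2 * Real.pi))) = G φ := by
    intro s
    induction s using Finset.induction_on with
    | empty => intro φ; simp
    | insert x s hx ih =>
      intro φ
      rw [Finset.sum_insert hx, add_comm (Pi.single x _), ← add_assoc, periodic_single_int G hG, ih]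
  have h := key Finset.univ φ
  rwa [Finset.univ_sum_single (fun x => (k x : ℝ) * (2 * Real.pi))] at h

/-! ### Descent to the unit torus `(ℝ/ℤ)^Λ` -/

/-- The descent of a function on `ℝ^Λ` (period `2π` in each coordinate) to the unit torus:
`t ↦ G(2π · lift t)` with the lift into `[-1/2, 1/2)^Λ`. [folklore] -/
def toTorusFn (G : (Λ → ℝ) → ℂ) (t : UnitAddTorus Λ) : ℂ :=
  G (fun x => (2 * Real.pi) * ((AddCircle.equivIco (1 : ℝ) (-(1 / 2 : ℝ)) (t x) : ℝ)))

/-- The lift of `y mod 1` differs from `y` by an integer. [folklore] -/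
theorem equivIco_coe_eq_add_int (y : ℝ) :
    ∃ n : ℤ, ((AddCircle.equivIco (1 : ℝ) (-(1 / 2 : ℝ)) (y : UnitAddCircle) : ℝ)) = y + n := by
  set v : ℝ := ((AddCircle.equivIco (1 : ℝ) (-(1 / 2 : ℝ)) (y : UnitAddCircle) : ℝ)) with hv
  have h1 : ((v : ℝ) : UnitAddCircle) = (y : UnitAddCircle) := AddCircle.coe_equivIco
  have h2 : (((v - y : ℝ)) : UnitAddCircle) = 0 := by rw [QuotientAddGroup.mk_sub]; exact sub_eq_zero.2 h1
  obtain ⟨n, hn⟩ := (AddCircle.coe_eq_zero_iff (1 : ℝ)).1 h2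
  exact ⟨n, by rw [zsmul_eq_mul, mul_one] at hn; linarith⟩

/-- **On points coming from `ℝ^Λ`, the descent is `G(2π y)`** (periodicity). [folklore] -/
theorem toTorusFn_coe (G : (Λ → ℝ) → ℂ)
    (hG : ∀ (φ : Λ → ℝ) (x : Λ), G (φ + Pi.single x (2 * Real.pi)) = G φ) (y : Λ → ℝ) :
    toTorusFn G (fun x => ((y x : ℝ) : UnitAddCircle)) = G (fun x => (2 * Real.pi) * y x) := by
  choose n hn using fun x => equivIco_coe_eq_add_int (y x)
  rw [toTorusFn]
  have : (fun x => (2 * Real.pi) * ((AddCircle.equivIco (1 : ℝ) (-(1 / 2 : ℝ)) (y x : UnitAddCircle) : ℝ))) =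
      (fun x => (2 * Real.pi) * y x) + fun x => (n x : ℝ) * (2 * Real.pi) := by
    funext x; rw [Pi.add_apply, hn x]; ring
  rw [this, periodic_shift G hG]

omit [DecidableEq Λ] in
/-- The descent is measurable for continuous `G`. [folklore] -/
theorem measurable_toTorusFn {G : (Λ → ℝ) → ℂ} (hGc : Continuous G) : Measurable (toTorusFn G) := by
  refine hGc.measurable.comp (measurable_pi_lambda _ fun x => ?_)
  exact measurable_const.mul (measurable_subtype_coe.comp
    ((AddCircle.measurableEquivIco (1 : ℝ) (-(1 / 2 : ℝ))).measurable.comp (measurable_pi_apply x)))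

omit [Fintype Λ] [DecidableEq Λ] in
/-- A continuous periodic function is bounded by its maximum over the closed cube `[-π, π]^Λ`
everywhere it is evaluated by the descent. [folklore] -/
theorem norm_toTorusFn_le {G : (Λ → ℝ) → ℂ} (hGc : Continuous G) :
    ∃ C : ℝ, ∀ t, ‖toTorusFn G t‖ ≤ C := by
  have hK : IsCompact (Set.univ.pi fun _ : Λ => Set.Icc (-Real.pi) Real.pi) :=
    isCompact_univ_pi fun _ => isCompact_Icc
  obtain ⟨C, hC⟩ := hK.exists_bound_of_continuousOn hGc.continuousOn
  refine ⟨C, fun t => hC _ (Set.mem_univ_pi.2 fun x => ?_)⟩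
  have h := (AddCircle.equivIco (1 : ℝ) (-(1 / 2 : ℝ)) (t x)).2
  rw [Set.mem_Ico] at h
  constructor <;> nlinarith [Real.pi_pos, h.1, h.2]

omit [DecidableEq Λ] in
/-- The descent of a continuous function is in `L²` of the (probability) torus. [folklore] -/
theorem memLp_toTorusFn {G : (Λ → ℝ) → ℂ} (hGc : Continuous G) : MemLp (toTorusFn G) 2 volume := by
  obtain ⟨C, hC⟩ := norm_toTorusFn_le (Λ := Λ) hGc
  exact MemLp.of_bound (measurable_toTorusFn hGc).aestronglyMeasurable C (ae_of_all _ hC)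

/-- The `L²` class of the descent. [folklore] -/
def toTorusL2 {G : (Λ → ℝ) → ℂ} (hGc : Continuous G) : Lp ℂ 2 (volume : Measure (UnitAddTorus Λ)) :=
  (memLp_toTorusFn hGc).toLp _

/-! ### Cell coefficients and the change of variables `φ = 2πy` -/

/-- The Fourier coefficient on the cell: `A(n) = ∫_{[-π,π)^Λ} G conj(e_n)`. [cite: KleinPerez1992, §3] -/
def fourierCoeffCell (G : (Λ → ℝ) → ℂ) (n : Λ → ℤ) : ℂ :=
  ∫ φ in angleCell Λ, G φ * conj (fourierFn n φ)

omit [DecidableEq Λ] in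
/-- Mathlib's monomial at `y mod 1` is our monomial at `2πy`, conjugated:
`mFourier (-n) (y mod 1) = conj (e_n (2πy))`. [folklore] -/
theorem mFourier_neg_coe (n : Λ → ℤ) (y : Λ → ℝ) :
    UnitAddTorus.mFourier (-n) (fun x => ((y x : ℝ) : UnitAddCircle)) =
      conj (fourierFn n (fun x => (2 * Real.pi) * y x)) := by
  rw [conj_fourierFn, fourierFn_eq_prod, UnitAddTorus.mFourier, ContinuousMap.coe_mk]
  refine Finset.prod_congr rfl fun x _ => ?_
  rw [Pi.neg_apply, fourier_coe_apply, Complex.ofReal_one, div_one]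
  congr 1
  push_cast
  ring

omit [Fintype Λ] [DecidableEq Λ] in
/-- The scaled box: `2π · ∏ (-1/2, 1/2] = ∏ (-π, π]`. [folklore] -/
theorem smul_IocBox :
    (2 * Real.pi) • {y : Λ → ℝ | ∀ i, y i ∈ Set.Ioc (-(1 / 2 : ℝ)) (-(1 / 2 : ℝ) + 1)} =
      Set.univ.pi fun _ : Λ => Set.Ioc (-Real.pi) Real.pi := by
  ext φ
  rw [Set.mem_smul_set_iff_inv_smul_mem₀ (by positivity : (2 * Real.pi : ℝ) ≠ 0), Set.mem_setOf_eq,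
    Set.mem_univ_pi]
  refine forall_congr' fun i => ?_
  rw [Pi.smul_apply, smul_eq_mul, Set.mem_Ioc, Set.mem_Ioc]
  have hπ : 0 < 2 * Real.pi := by positivity
  constructor
  · rintro ⟨h1, h2⟩
    constructor
    · have := mul_lt_mul_of_pos_left h1 hπ
      rw [← mul_assoc, mul_inv_cancel₀ hπ.ne', one_mul] at this; linarith
    · have := mul_le_mul_of_nonneg_left h2 hπ.le
      rw [← mul_assoc, mul_inv_cancel₀ hπ.ne', one_mul] at this; linarith
  · rintro ⟨h1, h2⟩
    rw [inv_mul_eq_div, lt_div_iff₀ hπ, div_le_iff₀ hπ]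
    constructor <;> linarith

omit [DecidableEq Λ] in
/-- The Ioc-cell and the Ico-cell `angleCell` differ by a null set. [folklore] -/
theorem IocBox_ae_eq_angleCell :
    (Set.univ.pi fun _ : Λ => Set.Ioc (-Real.pi) Real.pi) =ᵐ[volume] angleCell Λ := by
  rw [angleCell_eq_pi, volume_pi]
  exact Measure.univ_pi_Ioc_ae_eq_Icc.trans Measure.univ_pi_Ico_ae_eq_Icc.symm

omit [DecidableEq Λ] in
/-- **Change of variables `φ = 2πy`**: integrals over the unit box of `H(2πy)` are
`(2π)^{-|Λ|}` times integrals of `H` over the cell. [folklore] -/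
theorem integral_IocBox_comp_smul {E : Type*} [NormedAddCommGroup E] [NormedSpace ℝ E] (H : (Λ → ℝ) → E) :
    ∫ y in {y : Λ → ℝ | ∀ i, y i ∈ Set.Ioc (-(1 / 2 : ℝ)) (-(1 / 2 : ℝ) + 1)}, H ((2 * Real.pi) • y) =
      (((2 * Real.pi) ^ Fintype.card Λ)⁻¹ : ℝ) • ∫ φ in angleCell Λ, H φ := by
  have h := Measure.setIntegral_comp_smul_of_pos volume H
    {y : Λ → ℝ | ∀ i, y i ∈ Set.Ioc (-(1 / 2 : ℝ)) (-(1 / 2 : ℝ) + 1)} (by positivity : (0 : ℝ) < 2 * Real.pi)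
  rw [Module.finrank_pi, smul_IocBox, setIntegral_congr_set IocBox_ae_eq_angleCell] at h
  exact h

/-- **The Mathlib Fourier coefficients of the descent are the cell coefficients**:
`mFourierCoeff (toTorusL2 G) n = (2π)^{-|Λ|} ∫_{[-π,π)^Λ} G conj(e_n)`. [cite: KleinPerez1992, §3] -/
theorem mFourierCoeff_toTorusL2 {G : (Λ → ℝ) → ℂ} (hGc : Continuous G)
    (hG : ∀ (φ : Λ → ℝ) (x : Λ), G (φ + Pi.single x (2 * Real.pi)) = G φ) (n : Λ → ℤ) :
    UnitAddTorus.mFourierCoeff (toTorusL2 hGc) n =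
      (((2 * Real.pi) ^ Fintype.card Λ)⁻¹ : ℝ) • fourierCoeffCell G n := by
  unfold toTorusL2
  have h1 : UnitAddTorus.mFourierCoeff ((memLp_toTorusFn hGc).toLp _ : UnitAddTorus Λ → ℂ) n =
      UnitAddTorus.mFourierCoeff (toTorusFn G) n :=
    integral_congr_ae ((memLp_toTorusFn hGc).coeFn_toLp.mono fun t ht => by simp only [ht])
  rw [h1, UnitAddTorus.mFourierCoeff_eq_integral _ n (fun _ => -(1 / 2 : ℝ)), fourierCoeffCell,
    ← integral_IocBox_comp_smul]
  refine setIntegral_congr_fun (MeasurableSet.univ_pi' fun _ => measurableSet_Ioc) fun y _ => ?_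
  have e : ((2 * Real.pi) • y : Λ → ℝ) = fun x => (2 * Real.pi) * y x := rfl
  rw [mFourier_neg_coe, toTorusFn_coe G hG, smul_eq_mul, mul_comm, e]

/-- **The `L²` norm of the descent is the cell integral**:
`∫_{(ℝ/ℤ)^Λ} |toTorusL2 G|² = (2π)^{-|Λ|} ∫_{[-π,π)^Λ} |G|²`. [folklore] -/
theorem integral_norm_sq_toTorusL2 {G : (Λ → ℝ) → ℂ} (hGc : Continuous G)
    (hG : ∀ (φ : Λ → ℝ) (x : Λ), G (φ + Pi.single x (2 * Real.pi)) = G φ) :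
    ∫ t, ‖(toTorusL2 hGc : UnitAddTorus Λ → ℂ) t‖ ^ 2 =
      ((2 * Real.pi) ^ Fintype.card Λ)⁻¹ * ∫ φ in angleCell Λ, ‖G φ‖ ^ 2 := by
  unfold toTorusL2
  have h1 : ∫ t, ‖((memLp_toTorusFn hGc).toLp _ : UnitAddTorus Λ → ℂ) t‖ ^ 2 = ∫ t, ‖toTorusFn G t‖ ^ 2 :=
    integral_congr_ae ((memLp_toTorusFn hGc).coeFn_toLp.mono fun t ht => by simp only [ht])
  rw [h1, UnitAddTorus.integral_preimage _ (fun _ => -(1 / 2 : ℝ)), ← smul_eq_mul,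
    ← integral_IocBox_comp_smul (fun φ => ‖G φ‖ ^ 2)]
  refine setIntegral_congr_fun (MeasurableSet.univ_pi' fun _ => measurableSet_Ioc) fun y _ => ?_
  have e : ((2 * Real.pi) • y : Λ → ℝ) = fun x => (2 * Real.pi) * y x := rfl
  simp only [toTorusFn_coe G hG, e]

/-- **Parseval on the cell** (from the completeness of the Fourier system on `(ℝ/ℤ)^Λ`,
Mathlib's `UnitAddTorus.hasSum_sq_mFourierCoeff`): for continuous `G`, `2π`-periodic in every
angle, `Σ_{n ∈ ℤ^Λ} |∫_{[-π,π)^Λ} G conj(e_n)|² = (2π)^{|Λ|} ∫_{[-π,π)^Λ} |G|²`.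
[cite: KleinPerez1992, §3] -/
theorem hasSum_sq_fourierCoeffCell {G : (Λ → ℝ) → ℂ} (hGc : Continuous G)
    (hG : ∀ (φ : Λ → ℝ) (x : Λ), G (φ + Pi.single x (2 * Real.pi)) = G φ) :
    HasSum (fun n : Λ → ℤ => ‖fourierCoeffCell G n‖ ^ 2)
      ((2 * Real.pi) ^ Fintype.card Λ * ∫ φ in angleCell Λ, ‖G φ‖ ^ 2) := by
  set c : ℝ := (2 * Real.pi) ^ Fintype.card Λ with hc
  have hcpos : 0 < c := by positivity
  have h := UnitAddTorus.hasSum_sq_mFourierCoeff (toTorusL2 hGc)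
  have e : (fun i : Λ → ℤ => ‖UnitAddTorus.mFourierCoeff (toTorusL2 hGc : UnitAddTorus Λ → ℂ) i‖ ^ 2) =
      fun n => c⁻¹ ^ 2 * ‖fourierCoeffCell G n‖ ^ 2 := by
    funext n
    rw [mFourierCoeff_toTorusL2 hGc hG, norm_smul, mul_pow, Real.norm_of_nonneg (inv_nonneg.2 hcpos.le)]
  rw [e, integral_norm_sq_toTorusL2 hGc hG, ← hc] at h
  have h2 := h.mul_left (c ^ 2)
  have e1 : ∀ t : ℝ, c ^ 2 * (c⁻¹ ^ 2 * t) = t := fun t => by field_simp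
  have e2 : ∀ t : ℝ, c ^ 2 * (c⁻¹ * t) = c * t := fun t => by field_simp
  simp only [e1, e2] at h2
  exact h2

/-! ### The Galerkin boxes exhaust `ℤ^Λ`; Pythagoras; mean-square convergence -/

section Boxes

variable (M : ℕ)

/-- The box of frequencies of the Galerkin space of degree `M`: `{n(σ) : σ}` = `{n : |n_x| ≤ M}`.
[folklore] -/
def galerkinBox : Finset (Λ → ℤ) := Finset.univ.image (momVec M)

/-- Sums over the box are sums over the tensor indices. [folklore] -/
theorem sum_galerkinBox {β : Type*} [AddCommMonoid β] (f : (Λ → ℤ) → β) :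
    ∑ n ∈ galerkinBox M, f n = ∑ σ : TensorIndex Λ (2 * M + 1), f (momVec M σ) := by
  rw [galerkinBox, Finset.sum_image (fun _ _ _ _ h => momVec_injective M h)]

/-- Membership in the box: `|n_x| ≤ M` for all `x`. [folklore] -/
theorem mem_galerkinBox_iff (n : Λ → ℤ) : n ∈ galerkinBox M ↔ ∀ x, |n x| ≤ M := by
  rw [galerkinBox, Finset.mem_image]
  constructor
  · rintro ⟨σ, -, rfl⟩ x
    rw [momVec_apply, abs_le]
    have := (σ x).isLt
    constructor <;> omega
  · intro h
    refine ⟨fun x => ⟨(n x + M).toNat, ?_⟩, Finset.mem_univ _, ?_⟩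
    · have := abs_le.1 (h x); omega
    · funext x
      rw [momVec_apply]
      have := abs_le.1 (h x)
      simp only
      omega

/-- The boxes increase. [folklore] -/
theorem galerkinBox_mono : Monotone (galerkinBox (Λ := Λ)) := by
  intro M M' hMM n hn
  rw [mem_galerkinBox_iff] at hn ⊢
  exact fun x => (hn x).trans (by exact_mod_cast hMM)

/-- The boxes exhaust `ℤ^Λ`. [folklore] -/
theorem tendsto_galerkinBox : Tendsto (galerkinBox (Λ := Λ)) atTop atTop := by
  refine tendsto_atTop_finset_of_monotone galerkinBox_mono fun n => ?_
  refine ⟨Finset.univ.sup fun x => (n x).natAbs, (mem_galerkinBox_iff _ n).2 fun x => ?_⟩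
  have h := Finset.le_sup (f := fun x => (n x).natAbs) (Finset.mem_univ x)
  have : ((n x).natAbs : ℤ) ≤ (Finset.univ.sup fun x => (n x).natAbs : ℕ) := by exact_mod_cast h
  rw [← Int.natCast_natAbs]
  exact this

variable {M}

/-- **The box sums of `|A(n)|²` converge to `(2π)^{|Λ|} ∫ |G|²`.** [folklore] -/
theorem tendsto_sum_sq_fourierCoeffCell_box {G : (Λ → ℝ) → ℂ} (hGc : Continuous G)
    (hG : ∀ (φ : Λ → ℝ) (x : Λ), G (φ + Pi.single x (2 * Real.pi)) = G φ) :
    Tendsto (fun M : ℕ => ∑ σ : TensorIndex Λ (2 * M + 1), ‖fourierCoeffCell G (momVec M σ)‖ ^ 2) atTop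
      (𝓝 ((2 * Real.pi) ^ Fintype.card Λ * ∫ φ in angleCell Λ, ‖G φ‖ ^ 2)) := by
  have h := (hasSum_sq_fourierCoeffCell hGc hG).comp tendsto_galerkinBox
  refine h.congr fun M => ?_
  simp only [Function.comp_apply, sum_galerkinBox]

variable (M)

/-- The coefficient vector of the box partial sum `S_M G = Σ_{|n_x| ≤ M} (2π)^{-|Λ|} A(n) e_n`.
[cite: KleinPerez1992, §3] -/
def partialSumCoeff (G : (Λ → ℝ) → ℂ) : TensorIndex Λ (2 * M + 1) → ℂ :=
  fun σ => ((((2 * Real.pi) ^ Fintype.card Λ)⁻¹ : ℝ) : ℂ) * fourierCoeffCell G (momVec M σ)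

/-- `∫ G conj(P_c) = Σ_σ conj(c_σ) A(n(σ))`. [folklore] -/
theorem integral_mul_conj_trigPoly {G : (Λ → ℝ) → ℂ} (hGc : Continuous G) (c : TensorIndex Λ (2 * M + 1) → ℂ) :
    ∫ φ in angleCell Λ, G φ * conj (trigPoly M c φ) = ∑ σ, conj (c σ) * fourierCoeffCell G (momVec M σ) := by
  have hpt : ∀ φ : Λ → ℝ, G φ * conj (trigPoly M c φ) = ∑ σ, conj (c σ) * (G φ * conj (fourierFn (momVec M σ) φ)) := by
    intro φ
    rw [trigPoly, map_sum, mul_sum]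
    refine sum_congr rfl fun σ _ => ?_
    rw [map_mul]
    ring
  simp_rw [hpt]
  rw [integral_finsetSum _ (fun σ _ => ?_)]
  · refine sum_congr rfl fun σ _ => ?_
    rw [integral_const_mul, fourierCoeffCell]
  · exact integrableOn_angleCell_of_continuous (continuous_const.mul (hGc.mul (continuous_fourierFn _).star))

/-- **Pythagoras for a trigonometric approximation**:
`∫ |G - P_c|² = ∫ |G|² - 2 Re Σ_σ conj(c_σ) A(n(σ)) + (2π)^{|Λ|} Σ_σ |c_σ|²`. [folklore] -/
theorem integral_norm_sq_sub_trigPoly {G : (Λ → ℝ) → ℂ} (hGc : Continuous G) (c : TensorIndex Λ (2 * M + 1) → ℂ) :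
    ∫ φ in angleCell Λ, ‖G φ - trigPoly M c φ‖ ^ 2 =
      (∫ φ in angleCell Λ, ‖G φ‖ ^ 2) - 2 * (∑ σ, conj (c σ) * fourierCoeffCell G (momVec M σ)).re +
        (2 * Real.pi) ^ Fintype.card Λ * ∑ σ, ‖c σ‖ ^ 2 := by
  have hpt : ∀ φ : Λ → ℝ, ‖G φ - trigPoly M c φ‖ ^ 2 =
      ‖G φ‖ ^ 2 - 2 * RCLike.re (G φ * conj (trigPoly M c φ)) + ‖trigPoly M c φ‖ ^ 2 := by
    intro φ
    rw [← Complex.normSq_eq_norm_sq, ← Complex.normSq_eq_norm_sq, ← Complex.normSq_eq_norm_sq,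
      Complex.normSq_sub, RCLike.re_to_complex]
    ring
  simp_rw [hpt]
  have hK : IsCompact (Set.univ.pi fun _ : Λ => Set.Icc (-Real.pi) Real.pi) := isCompact_univ_pi fun _ => isCompact_Icc
  have hi1 : IntegrableOn (fun φ => ‖G φ‖ ^ 2) (angleCell Λ) :=
    ((hGc.norm.pow 2).continuousOn.integrableOn_compact hK).mono_set angleCell_subset_Icc
  have hi2 : IntegrableOn (fun φ => 2 * RCLike.re (G φ * conj (trigPoly M c φ))) (angleCell Λ) :=
    ((continuous_const.mul (RCLike.continuous_re.comp (hGc.mul (continuous_trigPoly M c).star))).continuousOn.integrableOn_compact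
      hK).mono_set angleCell_subset_Icc
  have hi3 : IntegrableOn (fun φ => ‖trigPoly M c φ‖ ^ 2) (angleCell Λ) :=
    (((continuous_trigPoly M c).norm.pow 2).continuousOn.integrableOn_compact hK).mono_set angleCell_subset_Icc
  have hre : ∫ φ in angleCell Λ, RCLike.re (G φ * conj (trigPoly M c φ)) =
      RCLike.re (∫ φ in angleCell Λ, G φ * conj (trigPoly M c φ)) :=
    integral_re (integrableOn_angleCell_of_continuous (hGc.mul (continuous_trigPoly M c).star))
  rw [integral_add ?_ hi3, integral_sub hi1 hi2, integral_const_mul, hre,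
    integral_mul_conj_trigPoly M hGc, integral_norm_sq_trigPoly, RCLike.re_to_complex]
  exact hi1.sub hi2

/-- **Mean-square error of the box partial sum**:
`∫ |G - S_M G|² = ∫ |G|² - (2π)^{-|Λ|} Σ_{|n_x| ≤ M} |A(n)|²`. [cite: KleinPerez1992, §3] -/
theorem integral_norm_sq_sub_fourierPartialSum {G : (Λ → ℝ) → ℂ} (hGc : Continuous G) :
    ∫ φ in angleCell Λ, ‖G φ - trigPoly M (partialSumCoeff M G) φ‖ ^ 2 =
      (∫ φ in angleCell Λ, ‖G φ‖ ^ 2) -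
        ((2 * Real.pi) ^ Fintype.card Λ)⁻¹ * ∑ σ : TensorIndex Λ (2 * M + 1), ‖fourierCoeffCell G (momVec M σ)‖ ^ 2 := by
  set κ : ℝ := (2 * Real.pi) ^ Fintype.card Λ with hκ
  have hκpos : 0 < κ := by positivity
  rw [integral_norm_sq_sub_trigPoly M hGc]
  have h1 : (∑ σ, conj (partialSumCoeff M G σ) * fourierCoeffCell G (momVec M σ)).re =
      κ⁻¹ * ∑ σ : TensorIndex Λ (2 * M + 1), ‖fourierCoeffCell G (momVec M σ)‖ ^ 2 := by
    rw [Complex.re_sum, mul_sum]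
    refine sum_congr rfl fun σ _ => ?_
    rw [partialSumCoeff, map_mul, Complex.conj_ofReal, mul_assoc, mul_comm (conj _), Complex.mul_conj,
      Complex.normSq_eq_norm_sq, ← Complex.ofReal_mul, Complex.ofReal_re]
  have h2 : ∑ σ, ‖partialSumCoeff M G σ‖ ^ 2 =
      κ⁻¹ ^ 2 * ∑ σ : TensorIndex Λ (2 * M + 1), ‖fourierCoeffCell G (momVec M σ)‖ ^ 2 := by
    rw [mul_sum]
    refine sum_congr rfl fun σ _ => ?_
    rw [partialSumCoeff, norm_mul, Complex.norm_real, Real.norm_of_nonneg (inv_nonneg.2 hκpos.le), mul_pow]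
  rw [h1, h2, ← hκ]
  field_simp
  ring

/-- **The box partial sums converge to `G` in mean square on the cell**:
`∫_{[-π,π)^Λ} |G - S_M G|² → 0` as `M → ∞`, for continuous `G`, `2π`-periodic in every angle.
[cite: KleinPerez1992, §3] -/
theorem tendsto_integral_norm_sq_sub_fourierPartialSum {G : (Λ → ℝ) → ℂ} (hGc : Continuous G)
    (hG : ∀ (φ : Λ → ℝ) (x : Λ), G (φ + Pi.single x (2 * Real.pi)) = G φ) :
    Tendsto (fun M : ℕ => ∫ φ in angleCell Λ, ‖G φ - trigPoly M (partialSumCoeff M G) φ‖ ^ 2) atTop (𝓝 0) := by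
  set κ : ℝ := (2 * Real.pi) ^ Fintype.card Λ with hκ
  have hκpos : 0 < κ := by positivity
  simp_rw [integral_norm_sq_sub_fourierPartialSum _ hGc]
  have h := (tendsto_sum_sq_fourierCoeffCell_box hGc hG).const_mul κ⁻¹
  rw [← hκ, ← mul_assoc, inv_mul_cancel₀ hκpos.ne', one_mul] at h
  have h2 := h.const_sub (∫ φ in angleCell Λ, ‖G φ‖ ^ 2)
  rwa [sub_self] at h2

end Boxes

end QuantumRotor

end Literature.MathematicalPhysics.QuantumLattice
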